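import Summits.QuantumFields.YangMills.Theorems.BalabanUVNodesN15KingModelGraphTreeDecayContinuumLegs
import Summits.QuantumFields.YangMills.Theorems.BalabanUVNodesN15KingModelGraphTreeLengthMinimal

/-!
# BalabanUVNodes ∕ N15 — THE KING-MODEL RUNG (PART Β-i): TREE DECAY OF THE CONTINUUM n-POINT KERNEL IN THE UNIT METRIC — `exp[−(δ∕|Υ|)·d_tree({b_υ})]`, UNIFORMLY IN `K`,
# FROM «TREE ≥ PAIR» ON `T_η` AND THE STAR BOUND ON `T^{(K)}` (Theorem 3.5 (3.38) ∕ (3.56)'s `exp[−δ dist({y_i})]` for the limit, at a `|Υ|`-degraded rate), BY NAME AT `A = 0`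
# (Track A, DAG node N15 = NE2; FAN-OUT v1.1 §N15 s3 «KING-MODEL RUNG … NE2's analogue DECIDED in the model»)

HONEST FRAMING.  Count-neutral (cell `pub-ymgap`, seat `pub-ymgap-dag-n15-e` g30; `--supports stmt-QuantumFields-27366 --as helper` = K3⁸
`SpineGivenEndpointR13SepCoPHV`).  TEMPLATE LITERATURE: C. King, *The U(1) Higgs model. I. The continuum limit*, Commun. Math. Phys. **102** (1986) 649–677
[King1986]: Theorem 3.5 (3.38) p. 660 and Proposition 3.6 (3.56) p. 662 (`exp[−δ dist({y_i}, …)]`, `dist` = «the length of the shortest tree graph connecting {u_i}», p. 660),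
Theorem 2.1 (i) (2.22) p. 654 — for the `K → ∞` limit of ONE DIAGRAM's n-point kernel in KING's OWN `A = 0` MODEL (part Β-h's `kingLegSeq`).  NOT `Z`, NOT Bałaban's `G(U)`,
NOT a node discharge; nothing continuum-ℝ⁴ ∕ OS ∕ mass-gap ∕ Clay.  0 `sorry`; standard axioms.  Pages re-read 2026-08-29.

THE PRINT.  p. 660 [PDF 12]: *«We define dist({u_i}) to be the length of the shortest tree graph connecting {u_i}»*, (3.38): *«… exp[−δ dist({y_i}, {z_j})]»*; p. 662 (3.56).

READING (declared; ours).  Part Β-h left the limit's decay PAIRWISE because the tree length is measured on `T_η` (scale `K`) at the base points `y_{b_υ}`, a `K`-dependent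
metric space.  A `K`-UNIFORM comparison WITHOUT a Steiner-ratio letter: on `T_η`, tree length ≥ any pair distance (part Α-f `kingDist_le_treeLength_anchors`), and base
points are `≥ |b − b′|_T − 1` apart (part Ψ), so every leg site is within `d_tree^{(η)} + 1` of the root site in the unit metric; on `T^{(K)}` the STAR bound (part Α-m
`treeLength_le_sum_dist`) gives `d_tree^{(K)}(b(Υ)) ≤ |Υ|·(d_tree^{(η)} + 1)`.  Hence ★ `exp[−δ·d_tree^{(η)}({y_b})] ≤ e^{δ}·exp[−(δ∕|Υ|)·d_tree^{(K)}(b(Υ))]` for EVERY `K`,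
and parts Α-l ∕ Α-g ∕ Β-h turn into: the n-point kernel and its consecutive differences carry the UNIT-METRIC TREE FACTOR `exp[−(δ∕|Υ|)·treeLength tdistT (b(Υ))]`
uniformly in `K`; so does the limit ⇒ ★★★ `|E^{(∞)}(G; {b_υ})| ≤ S_G Q^{|Υ|−1}e^{δ′}·exp[−(δ′∕|Υ|)·d_tree({b_υ})]` and the rate form with the same factor.  §3: NO hypothesis
for connected pseudoforests of `G`-lines in `1 ≤ d ≤ 3`.

WHAT THIS FILE PROVES (namespace `Summit.QuantumFields.YangMills.BalabanUVNodes.N15KingModelRung.Curved`).  §1 ★ `exp_treeLength_fine_le_unit` (the comparison),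
★ `kingLegSeq_succ_sub_le_tree`, ★ `kingLegSeq_abs_le_tree`.  §2 ★★ **`king_graphLegs_continuumLimit_tree`**, ★★★ **`king_graphLegs_limit_treeDecay`**.  §3 ★★
`king_pseudoforestLegs_continuumLimit_tree`, ★★ `king_pseudoforestLegs_limit_treeDecay`.

HONEST SCOPE.  (a) The rate `δ∕|Υ|` is the price of the star ∕ pair comparison; King's printed `exp[−δ dist]` has a `|Υ|`-free rate (a Steiner-ratio argument on the
unit lattice would restore it; not typed).  (b) One diagram of King's `A = 0` model at fixed torus; legs = the two kernel members of (3.71); p. 664's sentence the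
hypothesis of §2; §3.5 not typed.  (c) NOT Bałaban's `G(U)`; N15 untouched; counts unmoved.
Locators: [King1986] p.660 (dist), Thm 3.5 (3.38) p.660, Prop. 3.6 (3.56) p.662, Thm 2.1 (i) (2.22) p.654, (3.13) p.657, p.664.
-/

noncomputable section

open scoped BigOperators Topology
open Finset Filter

namespace Summit.QuantumFields.YangMills.BalabanUVNodes.N15KingModelRung.Curved

open Literature.MathematicalPhysics.QuantumFieldTheory.Balaban1983to89.B5Prop11Plancherel (Tor fine)
open Literature.MathematicalPhysics.QuantumFieldTheory.King1986.Torus (tdistT tdistT_nonneg)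
open Summit.QuantumFields.YangMills.BalabanUVNodes.N15KingModelRung (KingVolIndex kingVol kingVol_neZero basePt blockOf_basePt)
open Summit.QuantumFields.YangMills.BalabanUVNodes.N15KingModelRung.Graph

variable {d : ℕ} (L : ℕ) [NeZero L]

/-! ## §1 The comparison of tree lengths, and the n-point kernel's bounds with the unit-metric tree factor -/

section Compare

/-- ★ **TREE DECAY ON `T_η` DOMINATES TREE DECAY ON `T^{(K)}` AT A `|Υ|`-DEGRADED RATE, UNIFORMLY IN `K`**: for anchors at the base points `y_{b_υ}` of unit sites
`b : Υ → T^{(K)}` (`Υ` inhabited by `υ₀`) and `δ ≥ 0`,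
`exp[−δ·treeLength |·|_{η} {y_{b_υ}}] ≤ e^{δ}·exp[−(δ∕|Υ|)·treeLength |·|_T (b(Υ))]` — tree ≥ pair on `T_η` (part Α-f), base points `≥ |b−b′|_T − 1` apart (part Ψ), star
bound on `T^{(K)}` (part Α-m). [cite: King1986, p.660 («the length of the shortest tree graph connecting {u_i}»), (3.56) p.662] -/
theorem exp_treeLength_fine_le_unit (jv : KingVolIndex d) {Υ : Type} [Fintype Υ] [DecidableEq Υ] (b : Υ → Tor (kingVol L jv)) (υ₀ : Υ) {δ : ℝ} (hδ : 0 ≤ δ) :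
    haveI := kingVol_neZero L jv
    Real.exp (-(δ * treeLength (kingDist L jv) (anchors fun υ => some (basePt (L ^ jv.K) (kingVol L jv) (b υ)))))
      ≤ Real.exp δ * Real.exp (-(δ / Fintype.card Υ * treeLength (tdistT (kingVol L jv)) (univ.image b))) := by
  haveI := kingVol_neZero L jv
  have hL0 : (0 : ℝ) < L := by exact_mod_cast Nat.pos_of_ne_zero (NeZero.ne L)
  have hN : (0 : ℝ) < (L : ℝ) ^ jv.K := pow_pos hL0 _
  set tf : ℝ := treeLength (kingDist L jv) (anchors fun υ => some (basePt (L ^ jv.K) (kingVol L jv) (b υ))) with htf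
  have htf0 : 0 ≤ tf := treeLength_nonneg (fun x y => kingDist_nonneg L jv x y) _
  -- every leg site is within `tf + 1` of the root site in the unit metric
  have hleg : ∀ υ : Υ, tdistT (kingVol L jv) (b υ) (b υ₀) ≤ tf + 1 := fun υ => by
    have hpair := kingDist_le_treeLength_anchors L jv (fun υ => some (basePt (L ^ jv.K) (kingVol L jv) (b υ))) (υ₁ := υ) (υ₂ := υ₀)
      (y₁ := basePt (L ^ jv.K) (kingVol L jv) (b υ)) (y₂ := basePt (L ^ jv.K) (kingVol L jv) (b υ₀)) rfl rfl
    have h := mul_tdistT_blockOf_le (L ^ jv.K) (kingVol L jv) (basePt (L ^ jv.K) (kingVol L jv) (b υ)) (basePt (L ^ jv.K) (kingVol L jv) (b υ₀))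
    rw [blockOf_basePt, blockOf_basePt] at h
    push_cast at h
    have hdist : tdistT (kingVol L jv) (b υ) (b υ₀)
        ≤ kingDist L jv (basePt (L ^ jv.K) (kingVol L jv) (b υ)) (basePt (L ^ jv.K) (kingVol L jv) (b υ₀)) + 1 := by
      unfold kingDist
      rw [← sub_le_iff_le_add, le_div_iff₀ hN]
      nlinarith
    linarith
  -- star bound on the unit torus
  have hcardΥ : (0 : ℝ) < Fintype.card Υ := by exact_mod_cast Fintype.card_pos_iff.2 ⟨υ₀⟩
  have hstar : treeLength (tdistT (kingVol L jv)) (univ.image b) ≤ (Fintype.card Υ : ℝ) * (tf + 1) := by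
    refine (treeLength_le_sum_dist (tdistT (kingVol L jv)) (univ.image b) (b υ₀)).trans ?_
    calc ∑ u ∈ univ.image b, tdistT (kingVol L jv) u (b υ₀) ≤ ∑ _u ∈ univ.image b, (tf + 1) :=
          sum_le_sum fun u hu => by obtain ⟨υ, -, rfl⟩ := mem_image.1 hu; exact hleg υ
      _ = ((univ.image b).card : ℝ) * (tf + 1) := by rw [sum_const, nsmul_eq_mul]
      _ ≤ (Fintype.card Υ : ℝ) * (tf + 1) := by
          refine mul_le_mul_of_nonneg_right ?_ (by linarith)
          exact_mod_cast card_image_le.trans (card_univ (α := Υ)).le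
  have hkey : δ / Fintype.card Υ * treeLength (tdistT (kingVol L jv)) (univ.image b) ≤ δ * (tf + 1) := by
    rw [div_mul_eq_mul_div, div_le_iff₀ hcardΥ]
    nlinarith
  rw [← Real.exp_add]
  exact Real.exp_le_exp.2 (by linarith)

/-- ★ **CONSECUTIVE DIFFERENCES WITH THE UNIT-METRIC TREE FACTOR**: with part Α-g's `(A, γ, δ)`, under p. 664's sentence, for every `K`:
`|E^{(K+2)}(G; {y_b}) − E^{(K+1)}(G; {y_b})| ≤ ((e^{δ}A^{2m+nn+|Υ|}m!(m+|Υ|+1))·L^{−γ}·exp[−(δ∕|Υ|)·treeLength |·|_T (b(Υ))])·(L^{−γ})^K`.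
[cite: King1986, Prop. 3.6 (3.56) p.662, p.660, (3.10)–(3.11) p.656] -/
theorem kingLegSeq_succ_sub_le_tree (hLodd : Odd L) (hL : 2 ≤ L) {a : ℝ} (ha : 0 < a) {m0sq : ℝ} (hm0 : 0 ≤ m0sq) :
    ∃ A γ δ : ℝ, 1 ≤ A ∧ 0 < γ ∧ 0 < δ ∧ ∀ (msq : ℝ), 0 < msq → msq ≤ m0sq → ∀ (eM nn m : ℕ) (src tgt : Fin m → Fin (nn + 1)), (∀ v, LConn src tgt univ 0 v) →
      ∀ (κ : Fin m → Option (Fin (d + 1))), PosSubgraphsBy src tgt 0 ((d + 1 : ℕ) : ℝ) (fun ℓ => lineExp (d + 1) (κ ℓ)) →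
      ∀ (Υ : Type) [Fintype Υ] [DecidableEq Υ] (vtx : Υ → Fin (nn + 1)) (υ₀ : Υ), vtx υ₀ = 0 →
      ∀ (b : Υ → Tor (kingVol L (jvSucc (d := d) eM 0))) (κe : Υ → Option (Fin (d + 1))) (K : ℕ),
        haveI := kingVol_neZero L (jvSucc (d := d) eM 0)
        |kingLegSeq L a msq eM nn m src tgt κ Υ vtx b κe (K + 1) - kingLegSeq L a msq eM nn m src tgt κ Υ vtx b κe K|
          ≤ ((Real.exp δ * A ^ (2 * m + nn + Fintype.card Υ) * ((m.factorial : ℝ) * (m + Fintype.card Υ + 1))) * (L : ℝ) ^ (-γ)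
              * Real.exp (-(δ / Fintype.card Υ * treeLength (tdistT (kingVol L (jvSucc (d := d) eM 0))) (univ.image b)))) * ((L : ℝ) ^ (-γ)) ^ K := by
  obtain ⟨A, γ, δ, hA, hγ, hδ, H⟩ := king_prop36_extLegs_treeDecay_collected (d := d) L hLodd hL ha hm0
  refine ⟨A, γ, δ, hA, hγ, hδ, fun msq hm hcap eM nn m src tgt hconn κ hsub Υ _ _ vtx υ₀ hυ₀ b κe K => ?_⟩
  haveI := kingVol_neZero L (jvSucc (d := d) eM 0)
  set jv : KingVolIndex d := jvSucc (d := d) eM K with hjv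
  haveI := kingVol_neZero L jv
  have hL0 : (0 : ℝ) < L := by exact_mod_cast (show 0 < L by omega)
  have key := H msq hm hcap jv 1 le_rfl nn m src tgt hconn κ hsub Υ vtx υ₀ hυ₀ b κe
  have hlegs : (fun υ => kingExtLo L a msq (jvSucc (d := d) eM (K + 1)) (b υ) (κe υ)) = fun υ => kingExtHi L a msq jv 1 (b υ) (κe υ) :=
    funext fun υ => funext fun x' => (kingExtHi_jvSucc_eq L a msq eM K (b υ) (κe υ) x').symm
  have hdiff : kingLegSeq L a msq eM nn m src tgt κ Υ vtx b κe (K + 1) - kingLegSeq L a msq eM nn m src tgt κ Υ vtx b κe K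
      = graphValLS ((((L : ℝ) ^ (jv.K + 1))⁻¹) ^ (d + 1)) src tgt (fun ℓ => kingGLine L (kingVol L jv) a msq (jv.K + 1) (κ ℓ)) vtx
            (fun υ => kingExtHi L a msq jv 1 (b υ) (κe υ))
        - graphValLS ((((L : ℝ) ^ jv.K)⁻¹) ^ (d + 1)) src tgt (fun ℓ => kingGLine L (kingVol L jv) a msq jv.K (κ ℓ)) vtx
            (fun υ => kingExtLo L a msq jv (b υ) (κe υ)) := by
    unfold kingLegSeq
    rw [hlegs]
    rfl
  rw [hdiff]
  have htree := exp_treeLength_fine_le_unit L jv b υ₀ hδ.le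
  have hpow : (L : ℝ) ^ (-(γ * (jv.K : ℕ))) = (L : ℝ) ^ (-γ) * ((L : ℝ) ^ (-γ)) ^ K := by
    rw [show (-(γ * (jv.K : ℕ)) : ℝ) = (-γ) * ((K + 1 : ℕ) : ℝ) from by simp only [hjv, jvSucc]; ring,
      Real.rpow_mul (Nat.cast_nonneg L), Real.rpow_natCast, pow_succ, mul_comm]
  have hθ0 : 0 ≤ (L : ℝ) ^ (-(γ * (jv.K : ℕ))) := Real.rpow_nonneg hL0.le _
  have hC0 : 0 ≤ A ^ (2 * m + nn + Fintype.card Υ) * ((m.factorial : ℝ) * (m + Fintype.card Υ + 1)) := by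
    have := zero_le_one.trans hA; positivity
  rw [show (treeLength (tdistT (kingVol L (jvSucc (d := d) eM 0))) (univ.image b) : ℝ) = treeLength (tdistT (kingVol L jv)) (univ.image b) from rfl]
  calc _ ≤ _ := key
    _ ≤ (Real.exp δ * Real.exp (-(δ / Fintype.card Υ * treeLength (tdistT (kingVol L jv)) (univ.image b)))) * (L : ℝ) ^ (-(γ * (jv.K : ℕ)))
          * (A ^ (2 * m + nn + Fintype.card Υ) * ((m.factorial : ℝ) * (m + Fintype.card Υ + 1))) :=
        mul_le_mul_of_nonneg_right (mul_le_mul_of_nonneg_right htree hθ0) hC0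
    _ = _ := by rw [hpow]; ring

/-- ★ **A UNIFORM SIZE WITH THE UNIT-METRIC TREE FACTOR**: with part Α-l's `(C₁, C₂, Q, δ′)`, under p. 664's sentence, for every `K`:
`|E^{(K+1)}(G; {y_b})| ≤ ((Q·c368 δ′)·C₁^m C₂^{nn}·(Σ_π degConst)·Q^{|Υ|−1})·e^{δ′}·exp[−(δ′∕|Υ|)·treeLength |·|_T (b(Υ))]` — (3.38)'s tree decay, unit metric, `|Υ|`-degraded rate.
[cite: King1986, Thm 3.5 (3.38) p.660, p.660 (dist), p.664] -/
theorem kingLegSeq_abs_le_tree (hLodd : Odd L) (hL : 2 ≤ L) {a : ℝ} (ha : 0 < a) {m0sq : ℝ} (hm0 : 0 ≤ m0sq) :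
    ∃ C₁ C₂ Q δ : ℝ, 0 < C₁ ∧ 0 < C₂ ∧ 0 < Q ∧ 0 < δ ∧ ∀ (msq : ℝ), 0 < msq → msq ≤ m0sq →
      ∀ (eM nn m : ℕ) (src tgt : Fin m → Fin (nn + 1)), (∀ v, LConn src tgt univ 0 v) →
      ∀ (κ : Fin m → Option (Fin (d + 1))), PosSubgraphsBy src tgt 0 ((d + 1 : ℕ) : ℝ) (fun ℓ => lineExp (d + 1) (κ ℓ)) →
      ∀ (Υ : Type) [Fintype Υ] [DecidableEq Υ] (vtx : Υ → Fin (nn + 1)) (υ₀ : Υ), vtx υ₀ = 0 →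
      ∀ (b : Υ → Tor (kingVol L (jvSucc (d := d) eM 0))) (κe : Υ → Option (Fin (d + 1))) (K : ℕ),
        haveI := kingVol_neZero L (jvSucc (d := d) eM 0)
        |kingLegSeq L a msq eM nn m src tgt κ Υ vtx b κe K|
          ≤ ((Q * c368 d δ) * (C₁ ^ m * C₂ ^ nn
                * (∑ π : Equiv.Perm (Fin m), degConst L (kingDegList src tgt ((d + 1 : ℕ) : ℝ) (fun ℓ => lineExp (d + 1) (κ ℓ)) π))
                * Q ^ (Fintype.card Υ - 1)))
              * (Real.exp δ * Real.exp (-(δ / Fintype.card Υ * treeLength (tdistT (kingVol L (jvSucc (d := d) eM 0))) (univ.image b)))) := by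
  obtain ⟨C₁, C₂, Q, δ, hC₁, hC₂, hQ, hδ, H⟩ := king_graph_size_extLegs_treeDecay_subgraphs (d := d) L hLodd hL ha hm0
  refine ⟨C₁, C₂, Q, δ, hC₁, hC₂, hQ, hδ, fun msq hm hcap eM nn m src tgt hconn κ hsub Υ _ _ vtx υ₀ hυ₀ b κe K => ?_⟩
  haveI := kingVol_neZero L (jvSucc (d := d) eM 0)
  set jv : KingVolIndex d := jvSucc (d := d) eM K with hjv
  haveI := kingVol_neZero L jv
  have key := H msq hm hcap jv nn m src tgt hconn κ hsub Υ vtx υ₀ hυ₀ b κe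
  have hprod : ∏ _υ ∈ (univ : Finset Υ).erase υ₀, Q = Q ^ (Fintype.card Υ - 1) := by
    rw [prod_const, card_erase_of_mem (mem_univ _), card_univ]
  rw [hprod] at key
  have htree := exp_treeLength_fine_le_unit L jv b υ₀ hδ.le
  have hS0 : 0 ≤ (Q * c368 d δ) * (C₁ ^ m * C₂ ^ nn
      * (∑ π : Equiv.Perm (Fin m), degConst L (kingDegList src tgt ((d + 1 : ℕ) : ℝ) (fun ℓ => lineExp (d + 1) (κ ℓ)) π)) * Q ^ (Fintype.card Υ - 1)) := by
    have hdeg : 0 ≤ ∑ π : Equiv.Perm (Fin m), degConst L (kingDegList src tgt ((d + 1 : ℕ) : ℝ) (fun ℓ => lineExp (d + 1) (κ ℓ)) π) :=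
      sum_nonneg fun π _ => zero_le_one.trans (one_le_degConst L hL
        (posDegrees_of_posDegreesBy le_rfl (posDegreesBy_kingDegList_of_posSubgraphsBy le_rfl hsub π)))
    have := c368_pos d hδ
    positivity
  rw [show (treeLength (tdistT (kingVol L (jvSucc (d := d) eM 0))) (univ.image b) : ℝ) = treeLength (tdistT (kingVol L jv)) (univ.image b) from rfl]
  unfold kingLegSeq
  calc _ ≤ _ := key
    _ ≤ _ := by rw [mul_comm]; exact mul_le_mul_of_nonneg_left htree hS0

end Compare

/-! ## §2 The continuum n-point kernel with unit-metric tree decay -/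

section Limit

/-- ★★ **THE CONTINUUM n-POINT KERNEL EXISTS, WITH RATE AND UNIT-METRIC TREE DECAY AGAINST THE LIMIT** (Thm 2.1 (i)'s shape + (3.56)'s shape): with part Α-g's `(A, γ, δ)`,
under p. 664's sentence, there is `E^{(∞)}(G; {b_υ})` with `E^{(K+1)} → E^{(∞)}` and, for every `K`,
`|E^{(K+1)}(G; {y_b}) − E^{(∞)}(G; {b})| ≤ ((e^{δ}A^{2m+nn+|Υ|}m!(m+|Υ|+1))·L^{−γ}·exp[−(δ∕|Υ|)·d_tree({b_υ})])·(L^{−γ})^K∕(1 − L^{−γ})`.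
[cite: King1986, Thm 2.1 (i) (2.22) p.654, (3.13) p.657, Prop. 3.6 (3.56) p.662, p.660] -/
theorem king_graphLegs_continuumLimit_tree (hLodd : Odd L) (hL : 2 ≤ L) {a : ℝ} (ha : 0 < a) {m0sq : ℝ} (hm0 : 0 ≤ m0sq) :
    ∃ A γ δ : ℝ, 1 ≤ A ∧ 0 < γ ∧ 0 < δ ∧ ∀ (msq : ℝ), 0 < msq → msq ≤ m0sq → ∀ (eM nn m : ℕ) (src tgt : Fin m → Fin (nn + 1)), (∀ v, LConn src tgt univ 0 v) →
      ∀ (κ : Fin m → Option (Fin (d + 1))), PosSubgraphsBy src tgt 0 ((d + 1 : ℕ) : ℝ) (fun ℓ => lineExp (d + 1) (κ ℓ)) →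
      ∀ (Υ : Type) [Fintype Υ] [DecidableEq Υ] (vtx : Υ → Fin (nn + 1)) (υ₀ : Υ), vtx υ₀ = 0 →
      ∀ (b : Υ → Tor (kingVol L (jvSucc (d := d) eM 0))) (κe : Υ → Option (Fin (d + 1))),
      ∃ Einf : ℝ, Tendsto (kingLegSeq L a msq eM nn m src tgt κ Υ vtx b κe) atTop (𝓝 Einf) ∧
        ∀ K : ℕ,
          haveI := kingVol_neZero L (jvSucc (d := d) eM 0)
          |kingLegSeq L a msq eM nn m src tgt κ Υ vtx b κe K - Einf|
            ≤ ((Real.exp δ * A ^ (2 * m + nn + Fintype.card Υ) * ((m.factorial : ℝ) * (m + Fintype.card Υ + 1))) * (L : ℝ) ^ (-γ)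
                * Real.exp (-(δ / Fintype.card Υ * treeLength (tdistT (kingVol L (jvSucc (d := d) eM 0))) (univ.image b))))
              * ((L : ℝ) ^ (-γ)) ^ K / (1 - (L : ℝ) ^ (-γ)) := by
  obtain ⟨A, γ, δ, hA, hγ, hδ, H⟩ := kingLegSeq_succ_sub_le_tree (d := d) L hLodd hL ha hm0
  refine ⟨A, γ, δ, hA, hγ, hδ, fun msq hm hcap eM nn m src tgt hconn κ hsub Υ _ _ vtx υ₀ hυ₀ b κe => ?_⟩
  haveI := kingVol_neZero L (jvSucc (d := d) eM 0)
  have hL1r : (1 : ℝ) < L := by exact_mod_cast (show 1 < L by omega)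
  have hr1 : (L : ℝ) ^ (-γ) < 1 := Real.rpow_lt_one_of_one_lt_of_neg hL1r (by linarith)
  set C : ℝ := (Real.exp δ * A ^ (2 * m + nn + Fintype.card Υ) * ((m.factorial : ℝ) * (m + Fintype.card Υ + 1))) * (L : ℝ) ^ (-γ)
      * Real.exp (-(δ / Fintype.card Υ * treeLength (tdistT (kingVol L (jvSucc (d := d) eM 0))) (univ.image b))) with hC
  have hdistK : ∀ K, dist (kingLegSeq L a msq eM nn m src tgt κ Υ vtx b κe K) (kingLegSeq L a msq eM nn m src tgt κ Υ vtx b κe (K + 1))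
      ≤ C * ((L : ℝ) ^ (-γ)) ^ K := fun K => by
    rw [Real.dist_eq, abs_sub_comm]; exact H msq hm hcap eM nn m src tgt hconn κ hsub Υ vtx υ₀ hυ₀ b κe K
  obtain ⟨Einf, hlim⟩ := cauchySeq_tendsto_of_complete (cauchySeq_of_le_geometric _ C hr1 hdistK)
  refine ⟨Einf, hlim, fun K => ?_⟩
  rw [← Real.dist_eq]
  exact dist_le_of_le_geometric_of_tendsto _ C hr1 hdistK hlim K

/-- ★★★ **TREE DECAY OF THE CONTINUUM n-POINT KERNEL — (3.38)∕(3.56)'s `exp[−δ dist({y_i})]` FOR THE LIMIT, IN THE UNIT METRIC AT RATE `δ′∕|Υ|`, UNIFORMLY IN THE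
VOLUME.**  With part Α-l's `(C₁, C₂, Q, δ′)`: for every mass, volume exponent, CONNECTED numbered graph under p. 664's sentence, family `Υ` of King's legs (root at the
vertex `0`) at unit sites `b_υ` and every limit point `E^{(∞)}` of `E^{(K+1)}(G; {y_b})`:
`|E^{(∞)}(G; {b_υ})| ≤ ((Q·c368 δ′)·C₁^m C₂^{nn}·(Σ_π degConst)·Q^{|Υ|−1})·e^{δ′}·exp[−(δ′∕|Υ|)·treeLength |·|_T (b(Υ))]`.
[cite: King1986, Thm 3.5 (3.38) p.660, p.660 («shortest tree graph»), (3.13) p.657, p.664] -/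
theorem king_graphLegs_limit_treeDecay (hLodd : Odd L) (hL : 2 ≤ L) {a : ℝ} (ha : 0 < a) {m0sq : ℝ} (hm0 : 0 ≤ m0sq) :
    ∃ C₁ C₂ Q δ : ℝ, 0 < C₁ ∧ 0 < C₂ ∧ 0 < Q ∧ 0 < δ ∧ ∀ (msq : ℝ), 0 < msq → msq ≤ m0sq →
      ∀ (eM nn m : ℕ) (src tgt : Fin m → Fin (nn + 1)), (∀ v, LConn src tgt univ 0 v) →
      ∀ (κ : Fin m → Option (Fin (d + 1))), PosSubgraphsBy src tgt 0 ((d + 1 : ℕ) : ℝ) (fun ℓ => lineExp (d + 1) (κ ℓ)) →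
      ∀ (Υ : Type) [Fintype Υ] [DecidableEq Υ] (vtx : Υ → Fin (nn + 1)) (υ₀ : Υ), vtx υ₀ = 0 →
      ∀ (b : Υ → Tor (kingVol L (jvSucc (d := d) eM 0))) (κe : Υ → Option (Fin (d + 1))),
      ∀ Einf : ℝ, Tendsto (kingLegSeq L a msq eM nn m src tgt κ Υ vtx b κe) atTop (𝓝 Einf) →
        haveI := kingVol_neZero L (jvSucc (d := d) eM 0)
        |Einf| ≤ ((Q * c368 d δ) * (C₁ ^ m * C₂ ^ nn
                * (∑ π : Equiv.Perm (Fin m), degConst L (kingDegList src tgt ((d + 1 : ℕ) : ℝ) (fun ℓ => lineExp (d + 1) (κ ℓ)) π))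
                * Q ^ (Fintype.card Υ - 1)))
              * (Real.exp δ * Real.exp (-(δ / Fintype.card Υ * treeLength (tdistT (kingVol L (jvSucc (d := d) eM 0))) (univ.image b)))) := by
  obtain ⟨C₁, C₂, Q, δ, hC₁, hC₂, hQ, hδ, H⟩ := kingLegSeq_abs_le_tree (d := d) L hLodd hL ha hm0
  refine ⟨C₁, C₂, Q, δ, hC₁, hC₂, hQ, hδ, fun msq hm hcap eM nn m src tgt hconn κ hsub Υ _ _ vtx υ₀ hυ₀ b κe Einf hlim => ?_⟩
  exact le_of_tendsto ((continuous_abs.tendsto Einf).comp hlim)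
    (Eventually.of_forall fun K => H msq hm hcap eM nn m src tgt hconn κ hsub Υ vtx υ₀ hυ₀ b κe K)

end Limit

/-! ## §3 The hypothesis-free class: connected pseudoforests of `G`-lines, `1 ≤ d ≤ 3` -/

section Pseudoforest

/-- ★★ **THE CONTINUUM n-POINT KERNEL OF EVERY CONNECTED PSEUDOFOREST OF `G`-LINES WITH KING's LEGS: EXISTENCE, RATE AND UNIT-METRIC TREE DECAY — NO HYPOTHESIS**
(`1 ≤ d ≤ 3`). [cite: King1986, Thm 2.1 (i) (2.22) p.654, Prop. 3.6 (3.56) p.662, p.660, p.664] -/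
theorem king_pseudoforestLegs_continuumLimit_tree (hd1 : 1 ≤ d) (hd3 : d ≤ 3) (hLodd : Odd L) (hL : 2 ≤ L) {a : ℝ} (ha : 0 < a)
    {m0sq : ℝ} (hm0 : 0 ≤ m0sq) :
    ∃ A γ δ : ℝ, 1 ≤ A ∧ 0 < γ ∧ 0 < δ ∧ ∀ (msq : ℝ), 0 < msq → msq ≤ m0sq → ∀ (eM nn m : ℕ) (src tgt : Fin m → Fin (nn + 1)), (∀ v, LConn src tgt univ 0 v) →
      (∀ ℓ, src ℓ ≠ tgt ℓ) → (∀ S : Finset (Fin m), S.card ≤ (lineVerts src tgt S).card) →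
      (∀ S : Finset (Fin m), S.card = 2 → 3 ≤ (lineVerts src tgt S).card) →
      ∀ (Υ : Type) [Fintype Υ] [DecidableEq Υ] (vtx : Υ → Fin (nn + 1)) (υ₀ : Υ), vtx υ₀ = 0 →
      ∀ (b : Υ → Tor (kingVol L (jvSucc (d := d) eM 0))) (κe : Υ → Option (Fin (d + 1))),
      ∃ Einf : ℝ, Tendsto (kingLegSeq L a msq eM nn m src tgt (fun _ : Fin m => (none : Option (Fin (d + 1)))) Υ vtx b κe) atTop (𝓝 Einf) ∧
        ∀ K : ℕ,
          haveI := kingVol_neZero L (jvSucc (d := d) eM 0)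
          |kingLegSeq L a msq eM nn m src tgt (fun _ : Fin m => (none : Option (Fin (d + 1)))) Υ vtx b κe K - Einf|
            ≤ ((Real.exp δ * A ^ (2 * m + nn + Fintype.card Υ) * ((m.factorial : ℝ) * (m + Fintype.card Υ + 1))) * (L : ℝ) ^ (-γ)
                * Real.exp (-(δ / Fintype.card Υ * treeLength (tdistT (kingVol L (jvSucc (d := d) eM 0))) (univ.image b))))
              * ((L : ℝ) ^ (-γ)) ^ K / (1 - (L : ℝ) ^ (-γ)) := by
  obtain ⟨A, γ, δ, hA, hγ, hδ, H⟩ := king_graphLegs_continuumLimit_tree (d := d) L hLodd hL ha hm0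
  refine ⟨A, γ, δ, hA, hγ, hδ, fun msq hm hcap eM nn m src tgt hconn h1 h2 h3 Υ _ _ vtx υ₀ hυ₀ b κe => ?_⟩
  exact H msq hm hcap eM nn m src tgt hconn _ (posSubgraphsBy_lineExp_pseudoforest hd1 hd3 h1 h2 h3) Υ vtx υ₀ hυ₀ b κe

/-- ★★ **UNIT-METRIC TREE DECAY OF THE CONTINUUM KERNEL OF EVERY CONNECTED PSEUDOFOREST WITH KING's LEGS — NO HYPOTHESIS** (`1 ≤ d ≤ 3`).
[cite: King1986, Thm 3.5 (3.38) p.660, p.660 (dist), p.664] -/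
theorem king_pseudoforestLegs_limit_treeDecay (hd1 : 1 ≤ d) (hd3 : d ≤ 3) (hLodd : Odd L) (hL : 2 ≤ L) {a : ℝ} (ha : 0 < a)
    {m0sq : ℝ} (hm0 : 0 ≤ m0sq) :
    ∃ C₁ C₂ Q δ : ℝ, 0 < C₁ ∧ 0 < C₂ ∧ 0 < Q ∧ 0 < δ ∧ ∀ (msq : ℝ), 0 < msq → msq ≤ m0sq →
      ∀ (eM nn m : ℕ) (src tgt : Fin m → Fin (nn + 1)), (∀ v, LConn src tgt univ 0 v) →
      (∀ ℓ, src ℓ ≠ tgt ℓ) → (∀ S : Finset (Fin m), S.card ≤ (lineVerts src tgt S).card) →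
      (∀ S : Finset (Fin m), S.card = 2 → 3 ≤ (lineVerts src tgt S).card) →
      ∀ (Υ : Type) [Fintype Υ] [DecidableEq Υ] (vtx : Υ → Fin (nn + 1)) (υ₀ : Υ), vtx υ₀ = 0 →
      ∀ (b : Υ → Tor (kingVol L (jvSucc (d := d) eM 0))) (κe : Υ → Option (Fin (d + 1))),
      ∀ Einf : ℝ, Tendsto (kingLegSeq L a msq eM nn m src tgt (fun _ : Fin m => (none : Option (Fin (d + 1)))) Υ vtx b κe) atTop (𝓝 Einf) →
        haveI := kingVol_neZero L (jvSucc (d := d) eM 0)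
        |Einf| ≤ ((Q * c368 d δ) * (C₁ ^ m * C₂ ^ nn
                * (∑ π : Equiv.Perm (Fin m), degConst L (kingDegList src tgt ((d + 1 : ℕ) : ℝ)
                    (fun ℓ => lineExp (d + 1) ((fun _ : Fin m => (none : Option (Fin (d + 1)))) ℓ)) π))
                * Q ^ (Fintype.card Υ - 1)))
              * (Real.exp δ * Real.exp (-(δ / Fintype.card Υ * treeLength (tdistT (kingVol L (jvSucc (d := d) eM 0))) (univ.image b)))) := by
  obtain ⟨C₁, C₂, Q, δ, hC₁, hC₂, hQ, hδ, H⟩ := king_graphLegs_limit_treeDecay (d := d) L hLodd hL ha hm0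
  refine ⟨C₁, C₂, Q, δ, hC₁, hC₂, hQ, hδ, fun msq hm hcap eM nn m src tgt hconn h1 h2 h3 Υ _ _ vtx υ₀ hυ₀ b κe Einf hlim => ?_⟩
  exact H msq hm hcap eM nn m src tgt hconn _ (posSubgraphsBy_lineExp_pseudoforest hd1 hd3 h1 h2 h3) Υ vtx υ₀ hυ₀ b κe Einf hlim

end Pseudoforest

end Summit.QuantumFields.YangMills.BalabanUVNodes.N15KingModelRung.Curved

end
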